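import Summits.ABC.ABC.Theses.IneffectiveSubspace
import Literature.Barriers.ABC.EpsilonCannotBeDroppedProofs

/-!
# Disproof of `DepthCountedABC` (stmt-ABC-14938) — findings of the crux disprover, cycle 1

Crux (route `IneffectiveSubspace`, #5): `DepthCountedABC` —
`∀ K ∀ ε > 0 ∃ C(K, ε) > 0`, every abc triple with `ω₅(abc) := #{p : p⁵ ∣ abc} ≤ K` has
`c < C · rad(abc)^(1+ε)` ("abc on the depth cells").

FINDINGS (section letters = the sections below; everything not marked `sorry` is kernel-checked).

* **A. No kill short of `¬ABC`.** `depthCountedABC_of_abc : ABC → DepthCountedABC` (drop the cell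
  condition), hence `¬DepthCountedABC → ¬ABC`.  The K-uniform version IS `ABC`
  (`kUniform_iff_abc`); the route's cut is lossless: `ABC ↔ DepthCountedABC ∧ DeepRegimeABC`
  (`abc_iff_depthCounted_and_deepRegime`), so `¬ABC ↔ ¬#5 ∨ ¬#6` (`not_abc_iff`).  Every open stub of
  the picked line `Sketch` is likewise implied by `ABC` (section F), so no stub is refutable either.
* **B. Load-bearing hypotheses.** Coprimality and the equation `a + b = c` are load-bearing already on
  the cell `K = 1` (`false_without_coprime`: `(2ⁿ, 2ⁿ, 2ⁿ⁺¹)`; `false_without_sum`: `(1, 1, 2ⁿ)`);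
  dropping the cell condition gives `ABC` verbatim (`withoutDepth_iff_abc`); positivity of `a, b` is
  NOT load-bearing given coprimality (only `(0,1,1)`/`(1,0,1)` enter; `no_new_triples_without_pos`);
  the sign condition `0 < ε` IS (`false_without_eps_pos`, via section B2).
* **B2. The 5-free cell is infinite, certifiably.** Elementary counting sieve: at most `3X/64` of
  `[1, X]` is divisible by some `p⁵` (`card_not_fiveFree_le`), so there are arbitrarily large
  consecutive 5-free `n, n+1` (`exists_consecutive_fiveFree`) and cell 0 contains `(1, n, n+1)` with
  `c → ∞` (`cellZero_unbounded`).  This is the ONLY kind of infinite family whose cell membership we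
  can certify; every family of quality `≥ 1` has uncontrolled depth (sections E, G).
* **C. Calibration of the constants on the 5-free cell `K = 0`.** `(1, 80, 81) = (1, 2⁴5, 3⁴)` is in
  the cell with `rad = 30`, quality `log 81 / log 30 = 1.29203`: every admissible `C(0, ε)` satisfies
  `81 ≤ C · 30^(1+ε)` (`constant_floor`), so `C(0, ε) > 1` for `ε ≤ 1/4` (`not_constFree`), and NO
  constant-one form `c < rad(abc)^θ` holds on the cell for `θ ≤ 129/100` (`explicit_floor`, by
  `30¹²⁹ < 81¹⁰⁰`).  Also recorded: the 4-free witness `(1, 23³, 2³3²13²)` (quality 1.2555) — even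
  the 4-free cell is non-trivial — whereas the CUBE-free cell is trivial (`c² ≤ 2·rad²`,
  `cubeFree_trivial`) and cell 0 holds for free at exponent 2 (`cellZero_exponent_two`).
* **D. Natural strengthenings refuted.** One constant serving every `(K, ε)` is false
  (`not_uniform_constant`, from `Literature.Barriers.ABC.not_abc_uniform_constant`); constant-free and
  explicit-exponent forms: section C.
* **E. The `ε = 0` boundary is NOT refutable cell-wise with present knowledge — and why.**  The cell
  condition is an UPPER bound on `ω₅`, so a witness family must have CERTIFIED bounded depth in all
  three members; every printed `ε = 0` family (Granville–Tucker `2^{p(p−1)}`, Bombieri–Gubler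
  `3^{2^k}`, Stewart–Tijdeman) has uncontrolled `ω₅`.  Sharp form: for `T_k = (1, 3^(2^k) − 1, 3^(2^k))`
  an odd prime `q ≠ 3` is 5-deep iff `q⁵ ∣ 3^(q−1) − 1` (`deep_prime_of_Tk`), so
  `EpsZero → {q prime : q⁵ ∣ 3^(q−1) − 1}.Infinite` (`epsZero_imp_wieferich_infinite`): the `ε = 0`
  cell statement forces infinitely many depth-5 base-3 Wieferich primes (none is known; heuristically
  there are finitely many).  Equivalently `Wieferich3DepthFiveFinite → ¬EpsZero`.  More: for EVERY
  odd base `x ≥ 3`, `EpsZero → {q ∤ x : q⁵ ∣ x^(q−1) − 1}.Infinite` (`epsZero_imp_wieferich_infinite_base`,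
  family `(1, x^(2^k) − 1, x^(2^k))`) — heuristically almost all of these sets are EMPTY.  Contrast: for the
  deep-tail crux `DeepRegimeABC` the same boundary IS refuted outright
  (`Theorems/DeepRegimeABC/Negative/WithoutEps.lean`) because a LOWER bound on `ω₅` tolerates junk.
* **F. Line `Sketch` (lead prover-line-stmt-ABC-14938-0).** Open stubs `stub_LW4`,
  `stub_deepSmallFullSize`, `stub_allPowerRich`: each is implied by `ABC` (docstrings give the
  derivations; `LW4 ⟸ S4SmallMemberABC ⟸ ABC` with `ε ↦ 5ε`), joint sufficiency is the LANDED
  `stub_assembly`; mutation: `stub_LW4` without `Λ ≠ 0` is false at `x = (1,1,1,1)`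
  (`lw4_false_without_nonvanishing`); its positivity hypothesis is cosmetic.  No stub broken.
* **G. Near-misses (sorried, this workfile only).** `not_epsZero` (unconditional `ε = 0` refutation
  on a fixed cell) and `cellZero_quality_gt_one_infinite` (infinitely many 5-free triples of quality
  `> 1`): both need depth control along an infinite family = squarefree/cube-free values of Lucas
  sequences or Wieferich-type finiteness; out of reach, see docstrings.

* **H. Models (prose).** Function-field model `𝔽_p[t]`, `p ≥ 5`: the exceptional set of Mathlib's
  `Polynomial.abc` is the Frobenius image `k[X^p]³` (`Literature.Barriers.ABC.MasonStothersFailsInCharP`,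
  `masonStothers_charP_of_not_frobenius`), and a coprime triple in `k[X^p]³` has every prime of its
  two non-constant members at multiplicity `≥ p ≥ 5`, i.e. `ω₅ ≥ 2`.  So over `𝔽_p[t]` the cells
  `K ≤ 1` satisfy Mason–Stothers (abc with `ε = 0`, `C = 1`) while the cell `K = 2` fails without
  bound (`1 + t^(p^k) = (1 + t)^(p^k)`, quality `p^k/2`).  The model refutes nothing over `ℤ` (no
  Frobenius) but locates the crux: its `K ≥ 2` cells are exactly where characteristic-blind
  arguments must fail.

WHY THE CRUX RESISTS: it is `ABC ∩ {ω₅ ≤ K}` with `C` free per cell; `∃ C` absorbs every finite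
census (cell-0 record quality 1.29203 up to `3·10⁸`, kit j015220), no identity lowers `ω₅`, and the
only refuting object is an infinite bounded-depth family of quality `≥ 1 + δ` — i.e. `¬ABC` with extra
structure.  Landed negative lemmas: see `Theorems/DepthCountedABC/Negative/`.
-/

set_option linter.dupNamespace false

namespace Summit.ABC.ABC.Cruxes.DepthCountedABC.Disproof

open Literature.NumberTheory.DiophantineGeometry UniqueFactorizationMonoid
open Summit.ABC.ABC.Theses.IneffectiveSubspace

/-! ## 0. Vocabulary -/

/-- The 5-depth count `ω₅(n) = #{p prime : p⁵ ∣ n}` — verbatim the filter/card of the crux. -/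
def omega5 (n : ℕ) : ℕ := (n.primeFactors.filter (fun p => 5 ≤ n.factorization p)).card

theorem omega5_def (n : ℕ) :
    omega5 n = (n.primeFactors.filter (fun p => 5 ≤ n.factorization p)).card := rfl

/-- If every prime `p` with `p⁵ ∣ n` lies in `S`, then `ω₅(n) ≤ #S`. -/
theorem omega5_le_card {n : ℕ} (hn : n ≠ 0) (S : Finset ℕ)
    (h : ∀ p, p.Prime → p ^ 5 ∣ n → p ∈ S) : omega5 n ≤ S.card := by
  unfold omega5
  apply Finset.card_le_card
  intro p hp
  rw [Finset.mem_filter] at hp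
  have hpp := Nat.prime_of_mem_primeFactors hp.1
  exact h p hpp ((hpp.pow_dvd_iff_le_factorization hn).mpr hp.2)

/-- If no prime divides `n ≠ 0` to the fifth power then `ω₅(n) = 0`. -/
theorem omega5_eq_zero {n : ℕ} (hn : n ≠ 0) (h : ∀ p, p.Prime → ¬ p ^ 5 ∣ n) : omega5 n = 0 := by
  have := omega5_le_card hn ∅ (fun p hp h5 => absurd h5 (h p hp))
  simpa using this

/-- Powers of a prime have `ω₅ ≤ 1`. -/
theorem omega5_prime_pow_le {p m : ℕ} (hp : p.Prime) : omega5 (p ^ m) ≤ 1 := by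
  have hn : p ^ m ≠ 0 := pow_ne_zero _ hp.ne_zero
  have := omega5_le_card hn {p} (fun q hq h5 => by
    rw [Finset.mem_singleton]
    exact (Nat.prime_dvd_prime_iff_eq hq hp).mp (hq.dvd_of_dvd_pow (dvd_trans (dvd_pow_self q (by norm_num)) h5)))
  simpa using this

/-- The radical of a prime power `p^m`, `m ≠ 0`, is `p`. -/
theorem rad_prime_pow {p m : ℕ} (hp : p.Prime) (hm : m ≠ 0) : radical (p ^ m) = p := by
  rw [Nat.radical_eq_prod_primeFactors, Nat.primeFactors_prime_pow hm hp, Finset.prod_singleton]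

/-! ## A. No kill short of `¬ABC` -/

/-- `ABC ⟹ DepthCountedABC`: abc's own `C(ε)` serves every cell (drop the cell condition).
Hence the crux is refutable only by refuting the summit. [folklore] -/
theorem depthCountedABC_of_abc (h : _root_.ABC) : DepthCountedABC := by
  intro K ε hε
  obtain ⟨C, hC, hh⟩ := (ABC_iff.mp h) ε hε
  exact ⟨C, hC, fun a b c ht _ => hh a b c ht⟩

theorem not_abc_of_not_depthCountedABC (h : ¬ DepthCountedABC) : ¬ _root_.ABC :=
  fun habc => h (depthCountedABC_of_abc habc)

/-- **Lossless factorization** (the route's rev-16 cut, kernel-checked here for the disprover's use):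
`ABC ↔ DepthCountedABC ∧ DeepRegimeABC` — `→` drops the cell conditions, `←` is the case split at the
single cell `K(ε)` of `DeepRegimeABC` (the deciding theorem `closes` without its first two binders).
Hence `¬ABC ↔ ¬DepthCountedABC ∨ ¬DeepRegimeABC` (`not_abc_iff`): a counterexample to abc is either a
bounded-depth family (kills this crux) or a family with `ω₅ → ∞` (kills #6) — quintic breeding moves a
bounded-depth counterexample family into ever deeper cells but with quality margin `δ ↦ δ/(5+4δ)` per
step, so neither negation visibly implies the other. [folklore] -/
theorem abc_iff_depthCounted_and_deepRegime : _root_.ABC ↔ (DepthCountedABC ∧ DeepRegimeABC) := by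
  constructor
  · intro h
    refine ⟨depthCountedABC_of_abc h, ?_⟩
    intro ε hε
    obtain ⟨C, hC, hh⟩ := (ABC_iff.mp h) ε hε
    exact ⟨0, C, hC, fun a b c ht _ => hh a b c ht⟩
  · rintro ⟨h5, h6⟩
    rw [ABC_iff]
    intro ε hε
    obtain ⟨K, C₁, hC₁, h₁⟩ := h6 ε hε
    obtain ⟨C₂, _hC₂, h₂⟩ := h5 K ε hε
    refine ⟨max C₁ C₂, lt_max_of_lt_left hC₁, fun a b c habc => ?_⟩
    have hr : (0 : ℝ) ≤ ((rad a b c : ℕ) : ℝ) ^ (1 + ε) := Real.rpow_nonneg (Nat.cast_nonneg _) _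
    by_cases hK : K ≤ ((a * b * c).primeFactors.filter (fun p => 5 ≤ (a * b * c).factorization p)).card
    · exact (h₁ a b c habc hK).trans_le (mul_le_mul_of_nonneg_right (le_max_left _ _) hr)
    · exact (h₂ a b c habc (not_le.mp hK).le).trans_le
        (mul_le_mul_of_nonneg_right (le_max_right _ _) hr)

/-- The disprover's reading of the factorization: `¬ABC ↔ ¬DepthCountedABC ∨ ¬DeepRegimeABC`. -/
theorem not_abc_iff : ¬ _root_.ABC ↔ (¬ DepthCountedABC ∨ ¬ DeepRegimeABC) := by
  rw [abc_iff_depthCounted_and_deepRegime, not_and_or]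

/-- The `K`-uniform strengthening (one `C(ε)` for all cells) is literally `ABC`. -/
theorem kUniform_iff_abc :
    (∀ ε : ℝ, 0 < ε → ∃ C : ℝ, 0 < C ∧ ∀ K : ℕ, ∀ a b c : ℕ, IsABCTriple a b c →
      omega5 (a * b * c) ≤ K → (c : ℝ) < C * ((rad a b c : ℕ) : ℝ) ^ (1 + ε)) ↔ _root_.ABC := by
  rw [ABC_iff]
  constructor
  · intro h ε hε
    obtain ⟨C, hC, hh⟩ := h ε hε
    exact ⟨C, hC, fun a b c ht => hh (omega5 (a * b * c)) a b c ht le_rfl⟩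
  · intro h ε hε
    obtain ⟨C, hC, hh⟩ := h ε hε
    exact ⟨C, hC, fun K a b c ht _ => hh a b c ht⟩

/-- Monotonicity in the cell: the constant of cell `K'` serves every cell `K ≤ K'`. -/
theorem cell_mono {K K' : ℕ} (hKK : K ≤ K') {ε C : ℝ}
    (h : ∀ a b c : ℕ, IsABCTriple a b c → omega5 (a * b * c) ≤ K' →
      (c : ℝ) < C * ((rad a b c : ℕ) : ℝ) ^ (1 + ε)) :
    ∀ a b c : ℕ, IsABCTriple a b c → omega5 (a * b * c) ≤ K →
      (c : ℝ) < C * ((rad a b c : ℕ) : ℝ) ^ (1 + ε) :=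
  fun a b c ht hK => h a b c ht (hK.trans hKK)

/-! ## B. Load-bearing analysis -/

/-- The crux WITHOUT coprimality (positivity and `a + b = c` kept). -/
def WithoutCoprime : Prop :=
  ∀ K : ℕ, ∀ ε : ℝ, 0 < ε → ∃ C : ℝ, 0 < C ∧ ∀ a b c : ℕ, 0 < a → 0 < b → a + b = c →
    omega5 (a * b * c) ≤ K → (c : ℝ) < C * ((rad a b c : ℕ) : ℝ) ^ (1 + ε)

/-- The crux WITHOUT the equation `a + b = c` (positivity and even pairwise coprimality kept). -/
def WithoutSum : Prop :=
  ∀ K : ℕ, ∀ ε : ℝ, 0 < ε → ∃ C : ℝ, 0 < C ∧ ∀ a b c : ℕ, 0 < a → 0 < b → 0 < c →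
    Nat.Coprime a b → Nat.Coprime a c → Nat.Coprime b c →
    omega5 (a * b * c) ≤ K → (c : ℝ) < C * ((rad a b c : ℕ) : ℝ) ^ (1 + ε)

/-- Real-arithmetic core of both witnesses: `2^(n+1) < C · 2^(1+1)` fails once `4C < 2^n`. -/
theorem two_pow_witness (C : ℝ) : ∃ n : ℕ, 1 ≤ n ∧ ¬ ((2 : ℝ) ^ (n + 1) < C * (2 : ℝ) ^ ((1 : ℝ) + 1)) := by
  obtain ⟨n, hn⟩ := pow_unbounded_of_one_lt (4 * C) (by norm_num : (1 : ℝ) < 2)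
  refine ⟨n + 1, by omega, ?_⟩
  have h4 : (2 : ℝ) ^ ((1 : ℝ) + 1) = 4 := by
    rw [show (1 : ℝ) + 1 = ((2 : ℕ) : ℝ) by norm_num, Real.rpow_natCast]; norm_num
  rw [h4, not_lt]
  have : (2 : ℝ) ^ (n + 1 + 1) = 4 * 2 ^ n := by ring
  rw [this]
  nlinarith [pow_pos (by norm_num : (0 : ℝ) < 2) n]

/-- **Coprimality is load-bearing** (any proof must use it): `(2ⁿ, 2ⁿ, 2ⁿ⁺¹)` lies in the cell
`K = 1` (`abc = 2^(3n+1)`, `rad = 2`) and has `c = 2ⁿ⁺¹` unbounded against `C · 2^(1+ε)`.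
[folklore] -/
theorem false_without_coprime : ¬ WithoutCoprime := by
  intro h
  obtain ⟨C, hC, hh⟩ := h 1 1 one_pos
  obtain ⟨n, hn1, hn⟩ := two_pow_witness C
  have hprod : 2 ^ n * 2 ^ n * 2 ^ (n + 1) = 2 ^ (3 * n + 1) := by ring
  have hK : omega5 (2 ^ n * 2 ^ n * 2 ^ (n + 1)) ≤ 1 := by
    rw [hprod]; exact omega5_prime_pow_le Nat.prime_two
  have hrad : rad (2 ^ n) (2 ^ n) (2 ^ (n + 1)) = 2 := by
    rw [rad_def, hprod]; exact rad_prime_pow Nat.prime_two (by omega)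
  have := hh (2 ^ n) (2 ^ n) (2 ^ (n + 1)) (by positivity) (by positivity) (by ring) hK
  rw [hrad] at this
  push_cast at this
  exact hn this

/-- **The equation `a + b = c` is load-bearing**: `(1, 1, 2ⁿ)` is positive and pairwise coprime,
lies in the cell `K = 1`, and has `c = 2ⁿ` unbounded against `C · 2^(1+ε)`. [folklore] -/
theorem false_without_sum : ¬ WithoutSum := by
  intro h
  obtain ⟨C, hC, hh⟩ := h 1 1 one_pos
  obtain ⟨n, hn1, hn⟩ := two_pow_witness C
  have hprod : 1 * 1 * 2 ^ (n + 1) = 2 ^ (n + 1) := by ring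
  have hK : omega5 (1 * 1 * 2 ^ (n + 1)) ≤ 1 := by
    rw [hprod]; exact omega5_prime_pow_le Nat.prime_two
  have hrad : rad 1 1 (2 ^ (n + 1)) = 2 := by
    rw [rad_def, hprod]; exact rad_prime_pow Nat.prime_two (by omega)
  have := hh 1 1 (2 ^ (n + 1)) one_pos one_pos (by positivity) (Nat.coprime_one_left 1)
    (Nat.coprime_one_left _) (Nat.coprime_one_left _) hK
  rw [hrad] at this
  push_cast at this
  exact hn this

/-- **Dropping the cell condition gives `ABC` verbatim** (the vacuous `∀ K` aside). -/
theorem withoutDepth_iff_abc :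
    (∀ K : ℕ, ∀ ε : ℝ, 0 < ε → ∃ C : ℝ, 0 < C ∧ ∀ a b c : ℕ, IsABCTriple a b c →
      (c : ℝ) < C * ((rad a b c : ℕ) : ℝ) ^ (1 + ε)) ↔ _root_.ABC := by
  rw [ABC_iff]
  exact ⟨fun h => h 0, fun h _ => h⟩

/-- **Positivity is NOT load-bearing given coprimality**: with `a + b = c` and `Nat.Coprime a b`,
allowing `a = 0` or `b = 0` only admits `(0, 1, 1)` and `(1, 0, 1)` (`gcd(0, b) = b`), whose
`c = 1 < C` for any `C > 1`.  So the positivity clauses of `IsABCTriple` can be dropped at the cost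
`C ↦ max C 2` (information for the prover: nothing in a proof may hinge on them). [folklore] -/
theorem no_new_triples_without_pos {a b c : ℕ} (hsum : a + b = c) (hcop : Nat.Coprime a b)
    (h0 : a = 0 ∨ b = 0) : c = 1 := by
  rcases h0 with rfl | rfl
  · simp [Nat.coprime_zero_left] at hcop; omega
  · simp [Nat.coprime_zero_right] at hcop; omega


/-! ## B2. The 5-free cell is infinite: consecutive 5-free integers (elementary counting sieve)

The one CERTIFIED infinite family in a fixed cell that elementary counting gives: `(1, n, n+1)` with
`n(n+1)` 5-free.  Consequences: `cellZero_unbounded` (no finite census settles a cell) and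
`false_without_eps_pos` (the sign condition `0 < ε` is load-bearing: at `ε = −1` the crux would bound
`c` on cell 0).  Quality of these triples is `< 1`, so they say nothing at `ε = 0` (section E). -/

section Sieve
open Finset

/-- Telescoping bound: `Σ_{3 ≤ m ≤ M} 1/m⁵ + 1/(4M⁴) ≤ 1/64` for `M ≥ 2`. [folklore] -/
theorem sum_Icc_three_inv_pow_five_le (M : ℕ) (hM : 2 ≤ M) :
    ∑ m ∈ Finset.Icc 3 M, (1 : ℝ) / (m : ℝ) ^ 5 + 1 / (4 * (M : ℝ) ^ 4) ≤ 1 / 64 := by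
  induction M, hM using Nat.le_induction with
  | base => norm_num
  | succ M hM ih =>
    rw [Finset.sum_Icc_succ_top (by omega : 3 ≤ M + 1)]
    have hMpos : (0 : ℝ) < M := by exact_mod_cast (by omega : 0 < M)
    have key : (1 : ℝ) / ((M + 1 : ℕ) : ℝ) ^ 5 + 1 / (4 * ((M + 1 : ℕ) : ℝ) ^ 4) ≤ 1 / (4 * (M : ℝ) ^ 4) := by
      push_cast
      rw [div_add_div _ _ (by positivity) (by positivity), div_le_div_iff₀ (by positivity) (by positivity)]
      nlinarith [pow_pos hMpos 2, pow_pos hMpos 3, pow_pos hMpos 4, pow_pos hMpos 5, pow_pos hMpos 6,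
        pow_pos hMpos 7, pow_pos hMpos 8]
    linarith

/-- `Σ_{2 ≤ m ≤ M} 1/m⁵ ≤ 3/64` (`1/32` plus the telescoped tail `≤ 1/64`). [folklore] -/
theorem sum_Icc_two_inv_pow_five_le (M : ℕ) :
    ∑ m ∈ Finset.Icc 2 M, (1 : ℝ) / (m : ℝ) ^ 5 ≤ 3 / 64 := by
  rcases lt_or_ge M 2 with hM | hM
  · rw [Finset.Icc_eq_empty (by omega)]; norm_num
  have hsplit : Finset.Icc 2 M = insert 2 (Finset.Icc 3 M) := by
    ext m; simp only [Finset.mem_Icc, Finset.mem_insert]; omega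
  rw [hsplit, Finset.sum_insert (by simp)]
  have htail := sum_Icc_three_inv_pow_five_le M hM
  have hpos : (0 : ℝ) ≤ 1 / (4 * (M : ℝ) ^ 4) := by positivity
  have h32 : (1 : ℝ) / ((2 : ℕ) : ℝ) ^ 5 = 1 / 32 := by norm_num
  rw [h32]
  linarith

open scoped Classical in
/-- **At most `3X/64` of the integers in `[1, X]` are divisible by a fifth power of a prime.**
[folklore] -/
theorem card_not_fiveFree_le (X : ℕ) :
    ((((Finset.Ioc 0 X).filter (fun n => ∃ p, p.Prime ∧ p ^ 5 ∣ n)).card : ℕ) : ℝ) ≤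
      3 * (X : ℝ) / 64 := by
  set P := (Finset.range (X + 1)).filter Nat.Prime with hP
  have hsub : (Finset.Ioc 0 X).filter (fun n => ∃ p, p.Prime ∧ p ^ 5 ∣ n) ⊆
      P.biUnion (fun p => (Finset.Ioc 0 X).filter (fun n => p ^ 5 ∣ n)) := by
    intro n hn
    simp only [Finset.mem_filter, Finset.mem_Ioc] at hn
    obtain ⟨⟨hn0, hnX⟩, p, hp, hpn⟩ := hn
    simp only [hP, Finset.mem_biUnion, Finset.mem_filter, Finset.mem_range, Finset.mem_Ioc]
    refine ⟨p, ⟨?_, hp⟩, ⟨hn0, hnX⟩, hpn⟩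
    have h1 : p ^ 5 ≤ n := Nat.le_of_dvd hn0 hpn
    have h2 : p ≤ p ^ 5 := Nat.le_self_pow (by norm_num) p
    omega
  have hPsub : P ⊆ Finset.Icc 2 X := by
    intro p hp
    simp only [hP, Finset.mem_filter, Finset.mem_range] at hp
    simp only [Finset.mem_Icc]
    exact ⟨hp.2.two_le, by omega⟩
  calc ((((Finset.Ioc 0 X).filter (fun n => ∃ p, p.Prime ∧ p ^ 5 ∣ n)).card : ℕ) : ℝ)
      ≤ ((P.biUnion (fun p => (Finset.Ioc 0 X).filter (fun n => p ^ 5 ∣ n))).card : ℝ) := by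
        exact_mod_cast Finset.card_le_card hsub
    _ ≤ ((∑ p ∈ P, ((Finset.Ioc 0 X).filter (fun n => p ^ 5 ∣ n)).card : ℕ) : ℝ) := by
        exact_mod_cast Finset.card_biUnion_le
    _ = ∑ p ∈ P, (((X / p ^ 5 : ℕ)) : ℝ) := by
        push_cast
        refine Finset.sum_congr rfl fun p _ => ?_
        rw [Nat.Ioc_filter_dvd_card_eq_div]
    _ ≤ ∑ p ∈ P, (X : ℝ) / (p : ℝ) ^ 5 := by
        refine Finset.sum_le_sum fun p _ => ?_
        have := Nat.cast_div_le (m := X) (n := p ^ 5) (α := ℝ)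
        push_cast at this
        exact this
    _ ≤ ∑ m ∈ Finset.Icc 2 X, (X : ℝ) / (m : ℝ) ^ 5 :=
        Finset.sum_le_sum_of_subset_of_nonneg hPsub (fun m _ _ => by positivity)
    _ = (X : ℝ) * ∑ m ∈ Finset.Icc 2 X, (1 : ℝ) / (m : ℝ) ^ 5 := by
        rw [Finset.mul_sum]
        refine Finset.sum_congr rfl fun m _ => ?_
        ring
    _ ≤ (X : ℝ) * (3 / 64) := by
        gcongr
        exact sum_Icc_two_inv_pow_five_le X
    _ = 3 * (X : ℝ) / 64 := by ring

/-- **Arbitrarily large consecutive 5-free integers.**  For every `N` there is `n > N` with both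
`n` and `n + 1` free of fifth powers of primes (counting: in the window `(N, 2N + 64]` at most
`3(2N+64)/64 + 3(2N+65)/64 < N + 64` integers `n` have `n` or `n + 1` divisible by some `p⁵`).
[folklore] -/
theorem exists_consecutive_fiveFree (N : ℕ) :
    ∃ n, N < n ∧ (∀ p, p.Prime → ¬ p ^ 5 ∣ n) ∧ (∀ p, p.Prime → ¬ p ^ 5 ∣ n + 1) := by
  classical
  by_contra hno
  push Not at hno
  set X := 2 * N + 64 with hX
  set W := Finset.Ioc N X with hW
  set B1 := W.filter (fun n => ∃ p, p.Prime ∧ p ^ 5 ∣ n) with hB1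
  set B2 := W.filter (fun n => ∃ p, p.Prime ∧ p ^ 5 ∣ n + 1) with hB2
  have hcover : W ⊆ B1 ∪ B2 := by
    intro n hn
    have hnN : N < n := (Finset.mem_Ioc.mp hn).1
    rw [Finset.mem_union, hB1, hB2, Finset.mem_filter, Finset.mem_filter]
    by_cases h1 : ∃ p, p.Prime ∧ p ^ 5 ∣ n
    · exact Or.inl ⟨hn, h1⟩
    · push Not at h1
      obtain ⟨p, hp, hpn⟩ := hno n hnN h1
      exact Or.inr ⟨hn, p, hp, hpn⟩
  have hB1le : ((B1.card : ℕ) : ℝ) ≤ 3 * (X : ℝ) / 64 := by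
    have hsub : B1 ⊆ (Finset.Ioc 0 X).filter (fun n => ∃ p, p.Prime ∧ p ^ 5 ∣ n) := by
      intro n hn
      rw [hB1, Finset.mem_filter, hW, Finset.mem_Ioc] at hn
      rw [Finset.mem_filter, Finset.mem_Ioc]
      exact ⟨⟨by omega, hn.1.2⟩, hn.2⟩
    exact le_trans (by exact_mod_cast Finset.card_le_card hsub) (card_not_fiveFree_le X)
  have hB2le : ((B2.card : ℕ) : ℝ) ≤ 3 * ((X + 1 : ℕ) : ℝ) / 64 := by
    have hmap : B2.card = (B2.map ⟨fun n => n + 1, add_left_injective 1⟩).card :=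
      (Finset.card_map _).symm
    have hsub : B2.map ⟨fun n => n + 1, add_left_injective 1⟩ ⊆
        (Finset.Ioc 0 (X + 1)).filter (fun n => ∃ p, p.Prime ∧ p ^ 5 ∣ n) := by
      intro m hm
      rw [Finset.mem_map] at hm
      obtain ⟨n, hn, hm'⟩ := hm
      simp only [Function.Embedding.coeFn_mk] at hm'
      subst hm'
      rw [hB2, Finset.mem_filter, hW, Finset.mem_Ioc] at hn
      rw [Finset.mem_filter, Finset.mem_Ioc]
      obtain ⟨⟨_, hnX⟩, hp⟩ := hn
      exact ⟨⟨Nat.succ_pos n, Nat.succ_le_succ hnX⟩, hp⟩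
    rw [hmap]
    exact le_trans (by exact_mod_cast Finset.card_le_card hsub) (card_not_fiveFree_le (X + 1))
  have hWcard : W.card = X - N := by rw [hW, Nat.card_Ioc]
  have hle : W.card ≤ B1.card + B2.card :=
    le_trans (Finset.card_le_card hcover) (Finset.card_union_le _ _)
  have hleR : ((X - N : ℕ) : ℝ) ≤ (B1.card : ℝ) + (B2.card : ℝ) := by
    rw [← hWcard]; exact_mod_cast hle
  have hXN : ((X - N : ℕ) : ℝ) = (N : ℝ) + 64 := by
    rw [Nat.cast_sub (by omega)]; rw [hX]; push_cast; ring
  rw [hXN] at hleR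
  have hX' : (X : ℝ) = 2 * N + 64 := by rw [hX]; push_cast; ring
  have hX1 : ((X + 1 : ℕ) : ℝ) = 2 * N + 65 := by push_cast; rw [hX']; ring
  rw [hX'] at hB1le
  rw [hX1] at hB2le
  have hN0 : (0 : ℝ) ≤ N := Nat.cast_nonneg N
  linarith

/-- **The 5-free cell contains abc triples with arbitrarily large `c`**: `(1, n, n + 1)` with `n`,
`n + 1` consecutive 5-free integers.  So no cell of `DepthCountedABC` is settled by a finite census,
and `C(0, ε)` is a genuinely asymptotic constant. [folklore] -/
theorem cellZero_unbounded (N : ℕ) :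
    ∃ a b c : ℕ, IsABCTriple a b c ∧
      ((a * b * c).primeFactors.filter (fun p => 5 ≤ (a * b * c).factorization p)).card = 0 ∧
      N < c := by
  obtain ⟨n, hNn, hn, hn1⟩ := exists_consecutive_fiveFree N
  have hn0 : 0 < n := by omega
  refine ⟨1, n, n + 1, ⟨one_pos, hn0, add_comm 1 n, Nat.coprime_one_left n⟩, ?_, by omega⟩
  have hne : 1 * n * (n + 1) ≠ 0 := by positivity
  rw [Finset.card_eq_zero, Finset.filter_eq_empty_iff]
  intro p hp h5
  have hpp := Nat.prime_of_mem_primeFactors hp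
  have hdvd : p ^ 5 ∣ n * (n + 1) := by
    have := (hpp.pow_dvd_iff_le_factorization hne).mpr h5
    simpa [one_mul] using this
  have hcop : Nat.Coprime n (n + 1) := by simp
  -- p divides n or n + 1; the fifth power then divides that factor
  rcases (Nat.Prime.dvd_mul hpp).mp (dvd_trans (dvd_pow_self p (by norm_num)) hdvd) with h | h
  · have hc : Nat.Coprime (p ^ 5) (n + 1) :=
      Nat.Coprime.pow_left 5 (Nat.Coprime.coprime_dvd_left h hcop)
    exact hn p hpp (hc.dvd_of_dvd_mul_right hdvd)
  · have hc : Nat.Coprime (p ^ 5) n :=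
      Nat.Coprime.pow_left 5 (Nat.Coprime.coprime_dvd_left h hcop.symm)
    exact hn1 p hpp (hc.dvd_of_dvd_mul_left hdvd)

/-- **`0 < ε` is load-bearing (as a sign condition)**: the crux quantified over ALL real `ε` is
false — at `ε = −1` it asks for `c < C` on the 5-free cell, whose `c` is unbounded
(`cellZero_unbounded`).  (The boundary case `ε = 0` is the open question treated in
`EpsZeroWieferich.lean`.) [folklore] -/
theorem false_without_eps_pos :
    ¬ ∀ K : ℕ, ∀ ε : ℝ, ∃ C : ℝ, 0 < C ∧ ∀ a b c : ℕ, IsABCTriple a b c →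
      ((a * b * c).primeFactors.filter (fun p => 5 ≤ (a * b * c).factorization p)).card ≤ K →
      (c : ℝ) < C * ((rad a b c : ℕ) : ℝ) ^ (1 + ε) := by
  intro h
  obtain ⟨C, hC, hh⟩ := h 0 (-1)
  obtain ⟨a, b, c, ht, h0, hNc⟩ := cellZero_unbounded ⌈C⌉₊
  have := hh a b c ht (le_of_eq h0)
  rw [show (1 : ℝ) + -1 = 0 by ring, Real.rpow_zero, mul_one] at this
  have h1 : (C : ℝ) ≤ ⌈C⌉₊ := Nat.le_ceil C
  have h2 : ((⌈C⌉₊ : ℕ) : ℝ) < c := by exact_mod_cast hNc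
  linarith

end Sieve

/-! ## C. Calibration of the constants on the 5-free cell -/

/-- `(1, 80, 81)` is an abc triple. -/
theorem isABCTriple_1_80_81 : IsABCTriple 1 80 81 :=
  ⟨one_pos, by norm_num, by norm_num, Nat.coprime_one_left _⟩

/-- `rad(1 · 80 · 81) = rad(2⁴ · 3⁴ · 5) = 30`. -/
theorem rad_1_80_81 : rad 1 80 81 = 30 := by
  rw [rad_def, Nat.radical_eq_prod_primeFactors,
    show (1 * 80 * 81 : ℕ) = (2 ^ 4 * 3 ^ 4) * 5 ^ 1 by norm_num,
    Nat.primeFactors_mul (by norm_num) (by norm_num), Nat.primeFactors_mul (by norm_num) (by norm_num),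
    Nat.primeFactors_prime_pow (by norm_num) Nat.prime_two,
    Nat.primeFactors_prime_pow (by norm_num) Nat.prime_three,
    Nat.primeFactors_prime_pow (by norm_num) Nat.prime_five]
  decide

/-- `(1, 80, 81)` is 5-free: `ω₅(6480) = 0`. -/
theorem omega5_1_80_81 : omega5 (1 * 80 * 81) = 0 := by
  apply omega5_eq_zero (by norm_num)
  intro p hp h5
  have hp81 : p ∣ 2 ^ 4 * 3 ^ 4 * 5 := by
    have : p ∣ 1 * 80 * 81 := dvd_trans (dvd_pow_self p (by norm_num)) h5
    simpa using this
  have hp235 : p = 2 ∨ p = 3 ∨ p = 5 := by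
    rcases (Nat.Prime.dvd_mul hp).mp hp81 with h | h
    · rcases (Nat.Prime.dvd_mul hp).mp h with h | h
      · exact Or.inl ((Nat.prime_dvd_prime_iff_eq hp Nat.prime_two).mp (hp.dvd_of_dvd_pow h))
      · exact Or.inr (Or.inl ((Nat.prime_dvd_prime_iff_eq hp Nat.prime_three).mp (hp.dvd_of_dvd_pow h)))
    · exact Or.inr (Or.inr ((Nat.prime_dvd_prime_iff_eq hp Nat.prime_five).mp h))
  rcases hp235 with rfl | rfl | rfl <;> revert h5 <;> decide

/-- **Constant floor on cell 0.** Every admissible constant of the cell `K = 0` at exponent `1 + ε`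
satisfies `81 < C · 30^(1+ε)` (witness `(1, 2⁴·5, 3⁴)`, quality `1.29203`, the cell-0 record up to
`3·10⁸`, kit j015220). [folklore] -/
theorem constant_floor {ε C : ℝ}
    (h : ∀ a b c : ℕ, IsABCTriple a b c → omega5 (a * b * c) ≤ 0 →
      (c : ℝ) < C * ((rad a b c : ℕ) : ℝ) ^ (1 + ε)) :
    (81 : ℝ) < C * (30 : ℝ) ^ (1 + ε) := by
  have := h 1 80 81 isABCTriple_1_80_81 (le_of_eq omega5_1_80_81)
  rw [rad_1_80_81] at this
  exact_mod_cast this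

/-- `30^(5/4) ≤ 81` (since `30⁵ = 24 300 000 ≤ 43 046 721 = 81⁴`). -/
theorem rpow_thirty_five_fourths_le : (30 : ℝ) ^ ((1 : ℝ) + 1 / 4) ≤ 81 := by
  have h1 : (1 : ℝ) + 1 / 4 = ((5 : ℕ) : ℝ) * (((4 : ℕ) : ℝ))⁻¹ := by norm_num
  rw [h1, Real.rpow_natCast_mul (by norm_num : (0 : ℝ) ≤ 30)]
  have h81 : ((81 : ℝ) ^ (4 : ℕ)) ^ (((4 : ℕ) : ℝ))⁻¹ = 81 :=
    Real.pow_rpow_inv_natCast (by norm_num : (0 : ℝ) ≤ 81) (by norm_num : (4 : ℕ) ≠ 0)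
  rw [← h81]
  exact Real.rpow_le_rpow (by norm_num) (by norm_num) (by positivity)

/-- **The constant-free form is false on cell 0** (natural strengthening refuted): "`c < rad(abc)^(1+ε)`
for every 5-free abc triple and every `ε > 0`" fails at `ε = 1/4` on `(1, 80, 81)`:
`81 ≥ 30^(5/4) ≈ 70.2`.  So `C(0, ε) > 1` is forced for `ε ≤ 1/4` (indeed for `ε < 0.29203`).
[folklore] -/
theorem not_constFree :
    ¬ ∀ K : ℕ, ∀ ε : ℝ, 0 < ε → ∀ a b c : ℕ, IsABCTriple a b c → omega5 (a * b * c) ≤ K →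
      (c : ℝ) < ((rad a b c : ℕ) : ℝ) ^ (1 + ε) := by
  intro h
  have := h 0 (1 / 4) (by norm_num) 1 80 81 isABCTriple_1_80_81 (le_of_eq omega5_1_80_81)
  rw [rad_1_80_81] at this
  push_cast at this
  linarith [rpow_thirty_five_fourths_le]

/-- `30^(129/100) ≤ 81`, by the exact integer comparison `30¹²⁹ ≤ 81¹⁰⁰`. -/
theorem rpow_thirty_le_81 : (30 : ℝ) ^ ((129 : ℝ) / 100) ≤ 81 := by
  have h1 : (129 : ℝ) / 100 = ((129 : ℕ) : ℝ) * (((100 : ℕ) : ℝ))⁻¹ := by norm_num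
  rw [h1, Real.rpow_natCast_mul (by norm_num : (0 : ℝ) ≤ 30)]
  have h81 : ((81 : ℝ) ^ (100 : ℕ)) ^ (((100 : ℕ) : ℝ))⁻¹ = 81 :=
    Real.pow_rpow_inv_natCast (by norm_num : (0 : ℝ) ≤ 81) (by norm_num : (100 : ℕ) ≠ 0)
  rw [← h81]
  apply Real.rpow_le_rpow (by norm_num) ?_ (by positivity)
  have : (30 : ℕ) ^ 129 ≤ 81 ^ 100 := by norm_num
  exact_mod_cast this

/-- **Explicit-exponent floor on cell 0** (the cell-0 analogue of
`Literature.Barriers.ABC.ExplicitABCQualityFloor`): no constant-one form `c < rad(abc)^θ` holds for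
all 5-free abc triples when `θ ≤ 1.29`, witness `(1, 80, 81)` of quality `1.29203`.  (For ALL triples
the floor is Reyssat's `1.62991`, a triple with `ω₅ = 2`.) [folklore] -/
theorem explicit_floor {θ : ℝ} (hθ : θ ≤ 129 / 100) :
    ¬ ∀ a b c : ℕ, IsABCTriple a b c → omega5 (a * b * c) = 0 →
      (c : ℝ) < ((rad a b c : ℕ) : ℝ) ^ θ := by
  intro h
  have := h 1 80 81 isABCTriple_1_80_81 omega5_1_80_81
  rw [rad_1_80_81] at this
  push_cast at this
  have hmono : (30 : ℝ) ^ θ ≤ (30 : ℝ) ^ ((129 : ℝ) / 100) :=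
    Real.rpow_le_rpow_of_exponent_le (by norm_num) hθ
  linarith [rpow_thirty_le_81]

/-- The 4-free witness `(1, 23³, 2³3²13²) = (1, 12167, 12168)`: an abc triple … -/
theorem isABCTriple_1_12167_12168 : IsABCTriple 1 12167 12168 :=
  ⟨one_pos, by norm_num, by norm_num, Nat.coprime_one_left _⟩

/-- … with radical `2·3·13·23 = 1794` (quality `log 12168 / log 1794 = 1.2555`) … -/
theorem rad_1_12167_12168 : rad 1 12167 12168 = 1794 := by
  rw [rad_def, Nat.radical_eq_prod_primeFactors,
    show (1 * 12167 * 12168 : ℕ) = ((23 ^ 3 * 2 ^ 3) * 3 ^ 2) * 13 ^ 2 by norm_num,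
    Nat.primeFactors_mul (by norm_num) (by norm_num), Nat.primeFactors_mul (by norm_num) (by norm_num),
    Nat.primeFactors_mul (by norm_num) (by norm_num),
    Nat.primeFactors_prime_pow (by norm_num) (by norm_num : Nat.Prime 23),
    Nat.primeFactors_prime_pow (by norm_num) Nat.prime_two,
    Nat.primeFactors_prime_pow (by norm_num) Nat.prime_three,
    Nat.primeFactors_prime_pow (by norm_num) (by norm_num : Nat.Prime 13)]
  decide

/-- … in which every prime has exponent `≤ 3` (so it lies in the 4-free, a fortiori 5-free, cell). -/
theorem fourFree_1_12167_12168 : ∀ p, p.Prime → ¬ p ^ 4 ∣ 1 * 12167 * 12168 := by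
  intro p hp h4
  have hpd : p ∣ 23 ^ 3 * 2 ^ 3 * 3 ^ 2 * 13 ^ 2 := by
    have : p ∣ 1 * 12167 * 12168 := dvd_trans (dvd_pow_self p (by norm_num)) h4
    simpa using this
  have hp' : p = 23 ∨ p = 2 ∨ p = 3 ∨ p = 13 := by
    rcases (Nat.Prime.dvd_mul hp).mp hpd with h | h
    · rcases (Nat.Prime.dvd_mul hp).mp h with h | h
      · rcases (Nat.Prime.dvd_mul hp).mp h with h | h
        · exact Or.inl ((Nat.prime_dvd_prime_iff_eq hp (by norm_num)).mp (hp.dvd_of_dvd_pow h))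
        · exact Or.inr (Or.inl ((Nat.prime_dvd_prime_iff_eq hp Nat.prime_two).mp (hp.dvd_of_dvd_pow h)))
      · exact Or.inr (Or.inr (Or.inl ((Nat.prime_dvd_prime_iff_eq hp Nat.prime_three).mp (hp.dvd_of_dvd_pow h))))
    · exact Or.inr (Or.inr (Or.inr ((Nat.prime_dvd_prime_iff_eq hp (by norm_num)).mp (hp.dvd_of_dvd_pow h))))
  rcases hp' with rfl | rfl | rfl | rfl <;> revert h4 <;> decide

theorem omega5_1_12167_12168 : omega5 (1 * 12167 * 12168) = 0 :=
  omega5_eq_zero (by norm_num) fun p hp h5 =>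
    fourFree_1_12167_12168 p hp (dvd_trans (pow_dvd_pow p (by norm_num)) h5)

/-- If every prime exponent of `n ≠ 0` is at most `m`, then `n ≤ rad(n)^m`
(after `Cruxes/DepthCountedABC/SketchIdeator2.lean`, ideator 2). -/
theorem le_radical_pow_of_factorization_le {n m : ℕ} (hn : n ≠ 0)
    (h : ∀ p ∈ n.primeFactors, n.factorization p ≤ m) : n ≤ (radical n) ^ m := by
  have hself : ∏ p ∈ n.primeFactors, p ^ n.factorization p = n := by
    conv_rhs => rw [← Nat.prod_factorization_pow_eq_self hn]
    rw [Finsupp.prod, Nat.support_factorization]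
  calc n = ∏ p ∈ n.primeFactors, p ^ n.factorization p := hself.symm
    _ ≤ ∏ p ∈ n.primeFactors, p ^ m := by
        apply Finset.prod_le_prod'
        intro p hp
        exact Nat.pow_le_pow_right (Nat.pos_of_mem_primeFactors hp) (h p hp)
    _ = (∏ p ∈ n.primeFactors, p) ^ m := (Finset.prod_pow _ _ _)
    _ = (radical n) ^ m := by rw [Nat.radical_eq_prod_primeFactors]

/-- `c² ≤ 2·abc` for an abc triple. -/
theorem sq_le_two_mul_prod {a b c : ℕ} (h : IsABCTriple a b c) : c ^ 2 ≤ 2 * (a * b * c) := by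
  obtain ⟨ha, hb, hsum, -⟩ := h
  subst hsum
  obtain ⟨a', rfl⟩ : ∃ a', a = a' + 1 := ⟨a - 1, by omega⟩
  obtain ⟨b', rfl⟩ : ∃ b', b = b' + 1 := ⟨b - 1, by omega⟩
  have key : (a' + 1) + (b' + 1) ≤ 2 * ((a' + 1) * (b' + 1)) := by nlinarith [Nat.zero_le (a' * b')]
  calc ((a' + 1) + (b' + 1)) ^ 2 = ((a' + 1) + (b' + 1)) * ((a' + 1) + (b' + 1)) := by ring
    _ ≤ (2 * ((a' + 1) * (b' + 1))) * ((a' + 1) + (b' + 1)) := Nat.mul_le_mul_right _ key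
    _ = 2 * ((a' + 1) * (b' + 1) * ((a' + 1) + (b' + 1))) := by ring

/-- On the 5-free cell every prime exponent of `abc` is `≤ 4`. -/
theorem factorization_le_four_of_omega5_eq_zero {n : ℕ} (h : omega5 n = 0) :
    ∀ p ∈ n.primeFactors, n.factorization p ≤ 4 := by
  intro p hp
  by_contra hlt
  push Not at hlt
  have hmem : p ∈ n.primeFactors.filter (fun p => 5 ≤ n.factorization p) :=
    Finset.mem_filter.mpr ⟨hp, hlt⟩
  rw [omega5, Finset.card_eq_zero] at h
  rw [h] at hmem
  simp at hmem

/-- **Calibration: cell 0 is free at exponent 2** (`c² ≤ 2·rad(abc)⁴`, i.e. `c ≤ √2·rad²`; after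
ideator 2's `calibrationZero_holds`). The crux asks for exponent `1 + ε` instead of `2`. [folklore] -/
theorem cellZero_exponent_two {a b c : ℕ} (h : IsABCTriple a b c) (h0 : omega5 (a * b * c) = 0) :
    c ^ 2 ≤ 2 * (rad a b c) ^ 4 := by
  have hne : a * b * c ≠ 0 := by
    obtain ⟨ha, hb, hsum, -⟩ := h
    have hc : 0 < c := by omega
    positivity
  calc c ^ 2 ≤ 2 * (a * b * c) := sq_le_two_mul_prod h
    _ ≤ 2 * (radical (a * b * c)) ^ 4 :=
        Nat.mul_le_mul_left 2 (le_radical_pow_of_factorization_le hne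
          (factorization_le_four_of_omega5_eq_zero h0))
    _ = 2 * (rad a b c) ^ 4 := by rw [rad_def]

/-- **Calibration: the CUBE-free cell is trivial** (`c² ≤ 2·rad²`: exponent 1, constant `√2`; after
ideator 2's `cubeFreeTrivial_holds`).  So depth thresholds `≤ 3` carry no content; `4` already does
(`(1, 23³, 2³3²13²)`, quality 1.2555) and `5` is the crux. [folklore] -/
theorem cubeFree_trivial {a b c : ℕ} (h : IsABCTriple a b c)
    (h3 : ∀ p ∈ (a * b * c).primeFactors, (a * b * c).factorization p ≤ 2) :
    c ^ 2 ≤ 2 * (rad a b c) ^ 2 := by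
  have hne : a * b * c ≠ 0 := by
    obtain ⟨ha, hb, hsum, -⟩ := h
    have hc : 0 < c := by omega
    positivity
  calc c ^ 2 ≤ 2 * (a * b * c) := sq_le_two_mul_prod h
    _ ≤ 2 * (radical (a * b * c)) ^ 2 :=
        Nat.mul_le_mul_left 2 (le_radical_pow_of_factorization_le hne h3)
    _ = 2 * (rad a b c) ^ 2 := by rw [rad_def]

/-! ## D. Natural strengthenings refuted -/

/-- **One constant for every `(K, ε)` is false.**  `∃ C ∀ K ∀ ε > 0 …` would give, cell by cell,
one `C` serving every `ε > 0` on ALL abc triples (`K := ω₅(abc)`), i.e. `c ≤ C·rad(abc)` in the limit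
`ε → 0⁺` — Granville–Tucker's example kills that (`Literature.Barriers.ABC.not_abc_uniform_constant`).
So `C(K, ε) → ∞` as `ε → 0⁺` along SOME sequence of cells; whether it does on a FIXED cell is the open
question of section E. [cite: GranvilleTucker2002, p. 1227] -/
theorem not_uniform_constant :
    ¬ ∃ C : ℝ, ∀ K : ℕ, ∀ ε : ℝ, 0 < ε → ∀ a b c : ℕ, IsABCTriple a b c → omega5 (a * b * c) ≤ K →
      (c : ℝ) < C * ((rad a b c : ℕ) : ℝ) ^ (1 + ε) := by
  rintro ⟨C, hC⟩
  exact Literature.Barriers.ABC.not_abc_uniform_constant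
    ⟨C, fun ε hε a b c ht => hC (omega5 (a * b * c)) ε hε a b c ht le_rfl⟩

/-! ## E. The `ε = 0` boundary: reduction to depth-5 Wieferich primes in base 3 -/

/-- **EpsZero** — the crux with the exponent `1 + ε` replaced by `1` (even in the weak `≤` form, `C`
of either sign): "on every cell one constant gives `c ≤ C·rad(abc)`".  Expected FALSE (Robert–Stewart–
Tenenbaum heuristics predict `c > rad·(log rad)^A` infinitely often already among 5-free triples), but —
unlike `not_abc_epsilon_zero` for all triples and unlike the deep-tail crux — NOT refutable with present
knowledge: see `epsZero_imp_wieferich_infinite` and the near-miss `not_epsZero`. -/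
def EpsZero : Prop :=
  ∀ K : ℕ, ∃ C : ℝ, ∀ a b c : ℕ, IsABCTriple a b c → omega5 (a * b * c) ≤ K →
    (c : ℝ) ≤ C * ((rad a b c : ℕ) : ℝ)

/-- The depth-5 Wieferich primes in base 3: primes `q` with `q⁵ ∣ 3^(q−1) − 1`.  None is known
(the known base-3 Wieferich primes `q² ∣ 3^(q−1) − 1` are `11` and `1006003` — the only
ones below `5·10⁶` by the disprover's direct check — and both have `q² ‖ 3^(q−1) − 1`); heuristically the set is finite (expected size `Σ_q q⁻⁴ < 0.1`). [topic: Wieferich primes] -/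
def wieferichThreeDepthFive : Set ℕ := {q | q.Prime ∧ q ^ 5 ∣ 3 ^ (q - 1) - 1}

/-- **Order argument.** If `q` is prime, `q ∤ x`, the exponent `n` is coprime to `q`, and
`q^j ∣ xⁿ − 1`, then `q^j ∣ x^(q−1) − 1`: the order of `x` in `(ℤ/q^j)ˣ` divides
`gcd(n, q^(j−1)(q−1)) ∣ q − 1`. [folklore] -/
theorem prime_pow_dvd_pow_sub_one_of_coprime {q x n j : ℕ} (hq : q.Prime) (hqx : ¬ q ∣ x)
    (hn : Nat.Coprime n q) (h : q ^ j ∣ x ^ n - 1) : q ^ j ∣ x ^ (q - 1) - 1 := by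
  rcases Nat.eq_zero_or_pos j with rfl | hj
  · simp
  have hx0 : 0 < x := Nat.pos_of_ne_zero (fun h0 => hqx (h0 ▸ dvd_zero q))
  have hx1 : 1 ≤ x ^ n := Nat.one_le_pow _ _ hx0
  have hx1' : 1 ≤ x ^ (q - 1) := Nat.one_le_pow _ _ hx0
  have hcop : Nat.Coprime x (q ^ j) :=
    Nat.Coprime.pow_right j ((Nat.Prime.coprime_iff_not_dvd hq).mpr hqx).symm
  set u : (ZMod (q ^ j))ˣ := ZMod.unitOfCoprime x hcop with hu
  have hun : u ^ n = 1 := by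
    have hz : ((x ^ n - 1 : ℕ) : ZMod (q ^ j)) = 0 := (ZMod.natCast_eq_zero_iff _ _).mpr h
    rw [Nat.cast_sub hx1, Nat.cast_pow, Nat.cast_one, sub_eq_zero] at hz
    ext
    rw [Units.val_pow_eq_pow_val, hu, ZMod.coe_unitOfCoprime, Units.val_one]
    exact hz
  have hord_n : orderOf u ∣ n := orderOf_dvd_of_pow_eq_one hun
  have hord_tot : orderOf u ∣ q ^ (j - 1) * (q - 1) := by
    have := ZMod.pow_totient u
    rw [Nat.totient_prime_pow hq hj] at this
    exact orderOf_dvd_of_pow_eq_one this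
  have hcop2 : Nat.Coprime (orderOf u) (q ^ (j - 1)) :=
    Nat.Coprime.pow_right _ (Nat.Coprime.coprime_dvd_left hord_n hn)
  have hord : orderOf u ∣ q - 1 := hcop2.dvd_of_dvd_mul_left hord_tot
  have hu1 : u ^ (q - 1) = 1 := orderOf_dvd_iff_pow_eq_one.mp hord
  have hz : ((x : ZMod (q ^ j))) ^ (q - 1) = 1 := by
    have := congrArg Units.val hu1
    rwa [Units.val_pow_eq_pow_val, hu, ZMod.coe_unitOfCoprime, Units.val_one] at this
  have : ((x ^ (q - 1) - 1 : ℕ) : ZMod (q ^ j)) = 0 := by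
    rw [Nat.cast_sub hx1', Nat.cast_pow, Nat.cast_one, hz, sub_self]
  exact (ZMod.natCast_eq_zero_iff _ _).mp this

/-- **Deep primes of the family `T_k = (1, 3^(2^k) − 1, 3^(2^k))`.**  An odd prime `q ≠ 3` dividing
`abc = (3^(2^k) − 1)·3^(2^k)` to the fifth power is a depth-5 base-3 Wieferich prime.  So
`ω₅(T_k) ≤ 2 + #(wieferichThreeDepthFive)` for every `k`, IF that set is finite. [folklore] -/
theorem deep_prime_of_Tk {q k : ℕ} (hq : q.Prime) (hq2 : q ≠ 2) (hq3 : q ≠ 3)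
    (h : q ^ 5 ∣ 1 * (3 ^ (2 ^ k) - 1) * 3 ^ (2 ^ k)) : q ∈ wieferichThreeDepthFive := by
  refine ⟨hq, ?_⟩
  have hcop : Nat.Coprime (q ^ 5) (3 ^ (2 ^ k)) :=
    Nat.Coprime.pow _ _ ((Nat.coprime_primes hq Nat.prime_three).mpr hq3)
  have h5b : q ^ 5 ∣ 3 ^ (2 ^ k) - 1 := hcop.dvd_of_dvd_mul_right (by simpa [one_mul] using h)
  refine prime_pow_dvd_pow_sub_one_of_coprime hq ?_ ?_ h5b
  · intro h3
    exact hq3 ((Nat.prime_dvd_prime_iff_eq hq Nat.prime_three).mp h3)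
  · exact Nat.Coprime.pow_left _ ((Nat.coprime_primes Nat.prime_two hq).mpr (Ne.symm hq2))

/-- `2^(k+3) ∣ 3^(2^(k+1)) − 1` (in `ℤ`): `3² − 1 = 8`, and `x² − 1 = (x − 1)(x + 1)` with `x + 1` even. -/
theorem two_pow_dvd_three_pow_sub_one_int (k : ℕ) :
    (2 : ℤ) ^ (k + 3) ∣ (3 : ℤ) ^ (2 ^ (k + 1)) - 1 := by
  induction k with
  | zero => norm_num
  | succ k ih =>
    have hsq : (3 : ℤ) ^ (2 ^ (k + 1 + 1)) - 1 =
        ((3 : ℤ) ^ (2 ^ (k + 1)) - 1) * ((3 : ℤ) ^ (2 ^ (k + 1)) + 1) := by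
      rw [pow_succ 2 (k + 1), pow_mul]; ring
    have h2 : (2 : ℤ) ∣ (3 : ℤ) ^ (2 ^ (k + 1)) + 1 := by
      have h3 : Odd ((3 : ℤ) ^ (2 ^ (k + 1))) := Odd.pow ⟨1, by norm_num⟩
      obtain ⟨m, hm⟩ := h3
      exact ⟨m + 1, by rw [hm]; ring⟩
    rw [hsq, pow_succ]
    exact mul_dvd_mul ih h2

/-- `2^(k+3) ∣ 3^(2^(k+1)) − 1` (in `ℕ`). -/
theorem two_pow_dvd_three_pow_sub_one (k : ℕ) : 2 ^ (k + 3) ∣ 3 ^ (2 ^ (k + 1)) - 1 := by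
  have h := two_pow_dvd_three_pow_sub_one_int k
  have h1 : 1 ≤ 3 ^ (2 ^ (k + 1)) := Nat.one_le_pow _ _ (by norm_num)
  rw [← Int.natCast_dvd_natCast]
  push_cast [Nat.cast_sub h1]
  exact h

/-- Radical bound along `T_k`: if `b = 2^(k+3)·t > 0` then `rad(1 · b · 3^e)·2^(k+3) ≤ 6·b`
(indeed `rad ∣ 6t`). [folklore] -/
theorem rad_Tk_mul_le {b t e k : ℕ} (ht : b = 2 ^ (k + 3) * t) (hb : 0 < b) :
    rad 1 b (3 ^ e) * 2 ^ (k + 3) ≤ 6 * b := by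
  have ht0 : 0 < t := by
    rcases Nat.eq_zero_or_pos t with h0 | h0
    · simp [ht, h0] at hb
    · exact h0
  have hk6 : 6 * t ≠ 0 := by omega
  have hdvd : radical (1 * b * 3 ^ e) ∣ 6 * t := by
    rw [Nat.radical_dvd_iff hk6]
    intro q hq
    rw [Nat.mem_primeFactors] at hq ⊢
    obtain ⟨hqprime, hqdvd, -⟩ := hq
    refine ⟨hqprime, ?_, hk6⟩
    rw [one_mul] at hqdvd
    rcases (Nat.Prime.dvd_mul hqprime).mp hqdvd with h | h
    · rw [ht] at h
      rcases (Nat.Prime.dvd_mul hqprime).mp h with h1 | h1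
      · have := (Nat.prime_dvd_prime_iff_eq hqprime Nat.prime_two).mp (hqprime.dvd_of_dvd_pow h1)
        subst this
        exact dvd_mul_of_dvd_left (by norm_num) _
      · exact dvd_mul_of_dvd_right h1 _
    · have := (Nat.prime_dvd_prime_iff_eq hqprime Nat.prime_three).mp (hqprime.dvd_of_dvd_pow h)
      subst this
      exact dvd_mul_of_dvd_left (by norm_num) _
  have hle : radical (1 * b * 3 ^ e) ≤ 6 * t := Nat.le_of_dvd (by omega) hdvd
  calc rad 1 b (3 ^ e) * 2 ^ (k + 3) = radical (1 * b * 3 ^ e) * 2 ^ (k + 3) := rfl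
    _ ≤ 6 * t * 2 ^ (k + 3) := Nat.mul_le_mul_right _ hle
    _ = 6 * b := by rw [ht]; ring

/-- **`ε = 0` on the depth cells forces infinitely many depth-5 base-3 Wieferich primes.**
If `EpsZero` held, take `K := 2 + #W` (were `W = wieferichThreeDepthFive` finite) and its constant
`C`; the triple `T_k = (1, 3^(2^(k+1)) − 1, 3^(2^(k+1)))` lies in that cell (`deep_prime_of_Tk`) and has
`rad(abc) ≤ 6b/2^(k+3) < c/C` once `2^k > 6C` (`v₂(3^(2^(k+1)) − 1) = k + 3`), contradiction.  Hence
any proof that the exponent `1` fails on some FIXED cell must produce infinitely many such primes or a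
new bounded-depth family; conversely no proof of the crux can "simply set ε = 0 cell-wise" unless it
also proves `W` infinite. [folklore] -/
theorem epsZero_imp_wieferich_infinite (h : EpsZero) : wieferichThreeDepthFive.Infinite := by
  intro hfin
  set W := hfin.toFinset with hW
  obtain ⟨C, hC⟩ := h (W.card + 2)
  obtain ⟨k, hk⟩ := pow_unbounded_of_one_lt (6 * C) (by norm_num : (1 : ℝ) < 2)
  set e := 2 ^ (k + 1) with he
  have he0 : e ≠ 0 := by positivity
  have h3e : 2 ≤ 3 ^ e := by
    calc 2 ≤ 3 ^ 1 := by norm_num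
      _ ≤ 3 ^ e := Nat.pow_le_pow_right (by norm_num) (Nat.one_le_iff_ne_zero.mpr he0)
  set b := 3 ^ e - 1 with hb
  have hb_pos : 0 < b := by omega
  have hb_lt : b < 3 ^ e := by omega
  have habc : IsABCTriple 1 b (3 ^ e) := ⟨one_pos, hb_pos, by omega, Nat.coprime_one_left _⟩
  have hne : 1 * b * 3 ^ e ≠ 0 := by positivity
  -- the cell: deep primes are among {2, 3} ∪ W
  have hcell : omega5 (1 * b * 3 ^ e) ≤ W.card + 2 := by
    refine le_trans (omega5_le_card hne (insert 2 (insert 3 W)) ?_) ?_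
    · intro q hq h5
      by_cases hq2 : q = 2
      · simp [hq2]
      by_cases hq3 : q = 3
      · simp [hq3]
      have hqW : q ∈ wieferichThreeDepthFive := deep_prime_of_Tk hq hq2 hq3 (by simpa [hb, he] using h5)
      have : q ∈ W := by rw [hW, Set.Finite.mem_toFinset]; exact hqW
      simp [this]
    · calc (insert 2 (insert 3 W)).card ≤ (insert 3 W).card + 1 := Finset.card_insert_le _ _
        _ ≤ W.card + 1 + 1 := by
            have := Finset.card_insert_le 3 W
            omega
        _ = W.card + 2 := by ring
  have hle := hC 1 b (3 ^ e) habc hcell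
  -- the size: rad · 2^(k+3) ≤ 6 b
  obtain ⟨t, ht⟩ := two_pow_dvd_three_pow_sub_one k
  have key : rad 1 b (3 ^ e) * 2 ^ (k + 3) ≤ 6 * b := rad_Tk_mul_le ht hb_pos
  have keyR : (rad 1 b (3 ^ e) : ℝ) * 2 ^ (k + 3) ≤ 6 * b := by exact_mod_cast key
  have hbR : (0 : ℝ) < b := by exact_mod_cast hb_pos
  have hbltR : (b : ℝ) < ((3 ^ e : ℕ) : ℝ) := by exact_mod_cast hb_lt
  have h2k : (0 : ℝ) < 2 ^ (k + 3) := by positivity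
  rcases le_or_gt C 0 with hC0 | hC0
  · have : C * (rad 1 b (3 ^ e) : ℝ) ≤ 0 := mul_nonpos_of_nonpos_of_nonneg hC0 (Nat.cast_nonneg _)
    linarith
  · have hrad : (rad 1 b (3 ^ e) : ℝ) ≤ 6 * b / 2 ^ (k + 3) := by
      rw [le_div_iff₀ h2k]; exact keyR
    have hratio : 6 * C / 2 ^ (k + 3) < 1 := by
      rw [div_lt_one h2k]
      calc 6 * C < 2 ^ k := hk
        _ ≤ 2 ^ (k + 3) := pow_le_pow_right₀ (by norm_num) (by omega)
    have : C * (rad 1 b (3 ^ e) : ℝ) < ((3 ^ e : ℕ) : ℝ) :=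
      calc C * (rad 1 b (3 ^ e) : ℝ) ≤ C * (6 * b / 2 ^ (k + 3)) := by gcongr
        _ = (6 * C / 2 ^ (k + 3)) * b := by ring
        _ < 1 * b := by gcongr
        _ = b := one_mul _
        _ < ((3 ^ e : ℕ) : ℝ) := hbltR
    linarith

/-- Contrapositive, the usable form: **finitely many depth-5 base-3 Wieferich primes ⟹ `ε` cannot be
set to `0` on the cell `K = 2 + #W`** (in particular on the cell `K = 2` if there is none at all). -/
theorem not_epsZero_of_wieferich_finite (hW : wieferichThreeDepthFive.Finite) : ¬ EpsZero :=
  fun h => epsZero_imp_wieferich_infinite h hW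

/-- The same dichotomy read on the crux side: `EpsZero` restricted to ONE cell `K` already forces
every `T_k` out of that cell for large `k`, i.e. `ω₅(3^(2^(k+1)) − 1) → ∞` would follow — recorded as
the concrete prediction a prover of any `ε`-free cell statement would have to deliver. -/
theorem epsZero_cell_imp_Tk_escapes {K : ℕ} {C : ℝ}
    (hC : ∀ a b c : ℕ, IsABCTriple a b c → omega5 (a * b * c) ≤ K → (c : ℝ) ≤ C * ((rad a b c : ℕ) : ℝ))
    {k : ℕ} (hk : 6 * C < 2 ^ k) :
    K < omega5 (1 * (3 ^ (2 ^ (k + 1)) - 1) * 3 ^ (2 ^ (k + 1))) := by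
  by_contra hle'
  push Not at hle'
  set e := 2 ^ (k + 1) with he
  have he0 : e ≠ 0 := by positivity
  have h3e : 2 ≤ 3 ^ e := by
    calc 2 ≤ 3 ^ 1 := by norm_num
      _ ≤ 3 ^ e := Nat.pow_le_pow_right (by norm_num) (Nat.one_le_iff_ne_zero.mpr he0)
  set b := 3 ^ e - 1 with hb
  have hb_pos : 0 < b := by omega
  have hb_lt : b < 3 ^ e := by omega
  have habc : IsABCTriple 1 b (3 ^ e) := ⟨one_pos, hb_pos, by omega, Nat.coprime_one_left _⟩
  have hle := hC 1 b (3 ^ e) habc hle'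
  obtain ⟨t, ht⟩ := two_pow_dvd_three_pow_sub_one k
  have key : rad 1 b (3 ^ e) * 2 ^ (k + 3) ≤ 6 * b := rad_Tk_mul_le ht hb_pos
  have keyR : (rad 1 b (3 ^ e) : ℝ) * 2 ^ (k + 3) ≤ 6 * b := by exact_mod_cast key
  have hbR : (0 : ℝ) < b := by exact_mod_cast hb_pos
  have hbltR : (b : ℝ) < ((3 ^ e : ℕ) : ℝ) := by exact_mod_cast hb_lt
  have h2k : (0 : ℝ) < 2 ^ (k + 3) := by positivity
  rcases le_or_gt C 0 with hC0 | hC0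
  · have : C * (rad 1 b (3 ^ e) : ℝ) ≤ 0 := mul_nonpos_of_nonpos_of_nonneg hC0 (Nat.cast_nonneg _)
    linarith
  · have hrad : (rad 1 b (3 ^ e) : ℝ) ≤ 6 * b / 2 ^ (k + 3) := by
      rw [le_div_iff₀ h2k]; exact keyR
    have hratio : 6 * C / 2 ^ (k + 3) < 1 := by
      rw [div_lt_one h2k]
      calc 6 * C < 2 ^ k := hk
        _ ≤ 2 ^ (k + 3) := pow_le_pow_right₀ (by norm_num) (by omega)
    have : C * (rad 1 b (3 ^ e) : ℝ) < ((3 ^ e : ℕ) : ℝ) :=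
      calc C * (rad 1 b (3 ^ e) : ℝ) ≤ C * (6 * b / 2 ^ (k + 3)) := by gcongr
        _ = (6 * C / 2 ^ (k + 3)) * b := by ring
        _ < 1 * b := by gcongr
        _ = b := one_mul _
        _ < ((3 ^ e : ℕ) : ℝ) := hbltR
    linarith

/-! ### E'. The same in every odd base -/

/-- For odd `x`, `2^(k+3) ∣ x^(2^(k+1)) − 1` (in `ℤ`). -/
theorem two_pow_dvd_odd_pow_sub_one_int {x : ℤ} (hx : Odd x) (k : ℕ) :
    (2 : ℤ) ^ (k + 3) ∣ x ^ (2 ^ (k + 1)) - 1 := by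
  induction k with
  | zero =>
    obtain ⟨m, rfl⟩ := hx
    have h2 : (2 : ℤ) ∣ m * (m + 1) := by
      rcases Int.even_or_odd m with ⟨r, hr⟩ | ⟨r, hr⟩
      · exact ⟨r * (m + 1), by rw [hr]; ring⟩
      · exact ⟨m * (r + 1), by rw [hr]; ring⟩
    obtain ⟨r, hr⟩ := h2
    refine ⟨r, ?_⟩
    have : ((2 : ℤ) * m + 1) ^ (2 ^ (0 + 1)) - 1 = 4 * (m * (m + 1)) := by ring
    rw [this, hr]; ring
  | succ k ih =>
    have hsq : x ^ (2 ^ (k + 1 + 1)) - 1 = (x ^ (2 ^ (k + 1)) - 1) * (x ^ (2 ^ (k + 1)) + 1) := by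
      rw [pow_succ 2 (k + 1), pow_mul]; ring
    have h2 : (2 : ℤ) ∣ x ^ (2 ^ (k + 1)) + 1 := by
      obtain ⟨m, hm⟩ := Odd.pow hx (n := 2 ^ (k + 1))
      exact ⟨m + 1, by rw [hm]; ring⟩
    rw [hsq, pow_succ]
    exact mul_dvd_mul ih h2

/-- For odd `x`, `2^(k+3) ∣ x^(2^(k+1)) − 1` (in `ℕ`). -/
theorem two_pow_dvd_odd_pow_sub_one {x : ℕ} (hx : Odd x) (k : ℕ) :
    2 ^ (k + 3) ∣ x ^ (2 ^ (k + 1)) - 1 := by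
  have hxZ : Odd (x : ℤ) := by exact_mod_cast hx
  have h := two_pow_dvd_odd_pow_sub_one_int hxZ k
  have h1 : 1 ≤ x ^ (2 ^ (k + 1)) := Nat.one_le_pow _ _ hx.pos
  rw [← Int.natCast_dvd_natCast]
  push_cast [Nat.cast_sub h1]
  exact h

/-- Radical bound along `(1, x^e − 1, x^e)`: if `b = 2^(k+3)·t > 0` then
`rad(1 · b · x^e)·2^(k+3) ≤ 2·x·b` (`rad ∣ 2·t·x`). -/
theorem rad_base_mul_le {x b t e k : ℕ} (hx : 0 < x) (ht : b = 2 ^ (k + 3) * t) (hb : 0 < b) :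
    rad 1 b (x ^ e) * 2 ^ (k + 3) ≤ 2 * x * b := by
  have ht0 : 0 < t := by
    rcases Nat.eq_zero_or_pos t with h0 | h0
    · simp [ht, h0] at hb
    · exact h0
  have hk : 2 * t * x ≠ 0 := by positivity
  have hdvd : radical (1 * b * x ^ e) ∣ 2 * t * x := by
    rw [Nat.radical_dvd_iff hk]
    intro q hq
    rw [Nat.mem_primeFactors] at hq ⊢
    obtain ⟨hqprime, hqdvd, -⟩ := hq
    refine ⟨hqprime, ?_, hk⟩
    rw [one_mul] at hqdvd
    rcases (Nat.Prime.dvd_mul hqprime).mp hqdvd with h | h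
    · rw [ht] at h
      rcases (Nat.Prime.dvd_mul hqprime).mp h with h1 | h1
      · have := (Nat.prime_dvd_prime_iff_eq hqprime Nat.prime_two).mp (hqprime.dvd_of_dvd_pow h1)
        subst this
        exact dvd_mul_of_dvd_left (dvd_mul_right 2 t) _
      · exact dvd_mul_of_dvd_left (dvd_mul_of_dvd_right h1 2) _
    · exact dvd_mul_of_dvd_right (hqprime.dvd_of_dvd_pow h) _
  have hle : radical (1 * b * x ^ e) ≤ 2 * t * x := Nat.le_of_dvd (by positivity) hdvd
  calc rad 1 b (x ^ e) * 2 ^ (k + 3) = radical (1 * b * x ^ e) * 2 ^ (k + 3) := rfl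
    _ ≤ 2 * t * x * 2 ^ (k + 3) := Nat.mul_le_mul_right _ hle
    _ = 2 * x * b := by rw [ht]; ring

/-- **`ε = 0` on the depth cells forces infinitely many depth-5 Wieferich primes in EVERY odd base.**
For odd `x ≥ 3`: if every cell had an `ε`-free constant, then `{q prime : q ∤ x, q⁵ ∣ x^(q−1) − 1}` is
infinite (family `(1, x^(2^(k+1)) − 1, x^(2^(k+1)))`: its deep primes are `2`, the primes of `x`, and
such `q`; `v₂ ≥ k + 3` gives `rad ≤ 2xb/2^(k+3)`).  Heuristically each of these sets is finite and
almost all are empty. -/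
theorem epsZero_imp_wieferich_infinite_base {x : ℕ} (hx : Odd x) (hx3 : 3 ≤ x)
    (h : ∀ K : ℕ, ∃ C : ℝ, ∀ a b c : ℕ, IsABCTriple a b c →
      ((a * b * c).primeFactors.filter (fun p => 5 ≤ (a * b * c).factorization p)).card ≤ K →
      (c : ℝ) ≤ C * ((rad a b c : ℕ) : ℝ)) :
    {q : ℕ | q.Prime ∧ ¬ q ∣ x ∧ q ^ 5 ∣ x ^ (q - 1) - 1}.Infinite := by
  intro hfin
  set W := hfin.toFinset with hW
  obtain ⟨C, hC⟩ := h (W.card + x.primeFactors.card + 1)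
  have hx0 : 0 < x := by omega
  obtain ⟨k, hk⟩ := pow_unbounded_of_one_lt (2 * x * C) (by norm_num : (1 : ℝ) < 2)
  set e := 2 ^ (k + 1) with he
  have he0 : e ≠ 0 := by positivity
  have hxe : 2 ≤ x ^ e := by
    calc 2 ≤ x ^ 1 := by rw [pow_one]; omega
      _ ≤ x ^ e := Nat.pow_le_pow_right hx0 (Nat.one_le_iff_ne_zero.mpr he0)
  set b := x ^ e - 1 with hb
  have hb_pos : 0 < b := by omega
  have hb_lt : b < x ^ e := by omega
  have habc : IsABCTriple 1 b (x ^ e) := ⟨one_pos, hb_pos, by omega, Nat.coprime_one_left _⟩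
  have hne : 1 * b * x ^ e ≠ 0 := by positivity
  have hcell : ((1 * b * x ^ e).primeFactors.filter
      (fun p => 5 ≤ (1 * b * x ^ e).factorization p)).card ≤ W.card + x.primeFactors.card + 1 := by
    have hsub : (1 * b * x ^ e).primeFactors.filter (fun p => 5 ≤ (1 * b * x ^ e).factorization p) ⊆
        insert 2 (x.primeFactors ∪ W) := by
      intro q hq
      rw [Finset.mem_filter] at hq
      have hqp := Nat.prime_of_mem_primeFactors hq.1
      have h5 : q ^ 5 ∣ 1 * b * x ^ e := (hqp.pow_dvd_iff_le_factorization hne).mpr hq.2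
      rw [Finset.mem_insert, Finset.mem_union]
      by_cases hq2 : q = 2
      · exact Or.inl hq2
      by_cases hqx : q ∣ x
      · exact Or.inr (Or.inl (Nat.mem_primeFactors.mpr ⟨hqp, hqx, hx0.ne'⟩))
      right; right
      rw [hW, Set.Finite.mem_toFinset]
      refine ⟨hqp, hqx, ?_⟩
      have hcop : Nat.Coprime (q ^ 5) (x ^ e) :=
        Nat.Coprime.pow _ _ ((Nat.Prime.coprime_iff_not_dvd hqp).mpr hqx)
      have h5b : q ^ 5 ∣ x ^ e - 1 := hcop.dvd_of_dvd_mul_right (by simpa [one_mul, hb] using h5)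
      refine prime_pow_dvd_pow_sub_one_of_coprime hqp hqx ?_ h5b
      exact Nat.Coprime.pow_left _ ((Nat.coprime_primes Nat.prime_two hqp).mpr (Ne.symm hq2))
    calc _ ≤ (insert 2 (x.primeFactors ∪ W)).card := Finset.card_le_card hsub
      _ ≤ (x.primeFactors ∪ W).card + 1 := Finset.card_insert_le _ _
      _ ≤ x.primeFactors.card + W.card + 1 := by
          have := Finset.card_union_le x.primeFactors W
          omega
      _ = W.card + x.primeFactors.card + 1 := by ring
  have hle := hC 1 b (x ^ e) habc hcell
  obtain ⟨t, ht⟩ := two_pow_dvd_odd_pow_sub_one hx k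
  have key : rad 1 b (x ^ e) * 2 ^ (k + 3) ≤ 2 * x * b := rad_base_mul_le hx0 ht hb_pos
  have keyR : (rad 1 b (x ^ e) : ℝ) * 2 ^ (k + 3) ≤ 2 * x * b := by exact_mod_cast key
  have hbR : (0 : ℝ) < b := by exact_mod_cast hb_pos
  have hbltR : (b : ℝ) < ((x ^ e : ℕ) : ℝ) := by exact_mod_cast hb_lt
  have hxR : (0 : ℝ) < x := by exact_mod_cast hx0
  have h2k : (0 : ℝ) < 2 ^ (k + 3) := by positivity
  rcases le_or_gt C 0 with hC0 | hC0
  · have : C * (rad 1 b (x ^ e) : ℝ) ≤ 0 := mul_nonpos_of_nonpos_of_nonneg hC0 (Nat.cast_nonneg _)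
    linarith
  · have hrad : (rad 1 b (x ^ e) : ℝ) ≤ 2 * x * b / 2 ^ (k + 3) := by
      rw [le_div_iff₀ h2k]; exact keyR
    have hratio : 2 * x * C / 2 ^ (k + 3) < 1 := by
      rw [div_lt_one h2k]
      calc 2 * x * C < 2 ^ k := hk
        _ ≤ 2 ^ (k + 3) := pow_le_pow_right₀ (by norm_num) (by omega)
    have : C * (rad 1 b (x ^ e) : ℝ) < ((x ^ e : ℕ) : ℝ) :=
      calc C * (rad 1 b (x ^ e) : ℝ) ≤ C * (2 * x * b / 2 ^ (k + 3)) := by gcongr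
        _ = (2 * x * C / 2 ^ (k + 3)) * b := by ring
        _ < 1 * b := by gcongr
        _ = b := one_mul _
        _ < ((x ^ e : ℕ) : ℝ) := hbltR
    linarith

/-! ## F. Line `Sketch` (lead prover-line-stmt-ABC-14938-0): stub audit

Open stubs (skeleton 9068e4587b1f): `stub_LW4`, `stub_deepSmallFullSize`, `stub_allPowerRich`.
* `stub_LW4` ⟸ `S4SmallMemberABC` ⟸ `ABC`: for `x ∈ ℚ_{>0}⁴` write `∏ x_j^(j+1) = N/D` reduced,
  `N ≠ D` (else `Λ = 0`); `(|N − D|, min, max)` is an abc triple, `|Λ| = log(max/min) ≥ |N−D|/max`,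
  `S₄(N)S₄(D) ≤ ∏ num_j·den_j` (`⌈(Σ_j k_j v_j)/4⌉ ≤ Σ_j v_j` for `k_j ≤ 4`), and `ABC` gives
  `S4SmallMemberABC` with `ε ↦ 5ε` (`a^ε ≤ c^ε ≤ S₄(c)^(4ε)` since `S₄(n) ≥ n^(1/4)`).  Not refutable.
  Mutations: without `Λ ≠ 0` it is false at `x = (1,1,1,1)` (`lw4_false_without_nonvanishing`); the
  positivity hypothesis `0 < x_j` is cosmetic (`Real.log`/`natAbs` are sign-blind, `x_j = 0` makes the
  height `0` and `0^(−s) = 0`).  The `ε = 0` version of `LW4` (|Λ| ≥ C⁻¹/H) is NOT obviously false: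
  it needs abc triples with `a·S₄(b)S₄(c) = o(b)`, i.e. two consecutive-ish integers both far from
  4-th-power-free-radical-like; Pell `x² + 1 = 2y²` only reaches `|Λ|·H ≍ 1`.
* `stub_deepSmallFullSize` ⟸ `ABC` (`rad(abc) ≤ rad(a)·rad(bc) ≤ a·rad(bc)`); when `a` is the LARGE
  summand it is trivial (`a·rad(bc) ≥ a ≥ c/2`).  Its `δ = 0` version on cell 1 would be killed by
  `(1, 2ⁿ − 1, 2ⁿ)`, `n = p(p−1)` — IF `ω₅(2ⁿ − 1)` were certified bounded: the same Wieferich-type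
  obstruction as section E.  Not refutable.
* `stub_allPowerRich` ⟸ the crux on its cell ⟸ `ABC`.  Not refutable.
* Joint sufficiency is the LANDED `Summit.ABC.ABC.Theorems.DepthCountedABC.stub_assembly` (p96745):
  nothing smuggled.
-/

/-- Card 1's four-logarithm form `Λ₄(x) = Σ_{j=1}^{4} j·log x_j` (verbatim from `Lines/Sketch.lean`). -/
noncomputable def fourLog (x : Fin 4 → ℚ) : ℝ :=
  ∑ j : Fin 4, ((j.val : ℝ) + 1) * Real.log ((x j : ℚ) : ℝ)

/-- Card 1's product height `∏_j num(x_j)·den(x_j)` (verbatim from `Lines/Sketch.lean`). -/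
def prodHeight (x : Fin 4 → ℚ) : ℕ :=
  ∏ j : Fin 4, (x j).num.natAbs * (x j).den

/-- **`stub_LW4` without the non-vanishing hypothesis `Λ ≠ 0` is false** at `x = (1,1,1,1)`:
`Λ = 0`, height `1`, so the bound reads `C⁻¹ ≤ 0`. (The hypothesis is load-bearing, trivially.) -/
theorem lw4_false_without_nonvanishing :
    ¬ ∀ ε : ℝ, 0 < ε → ∃ C : ℝ, 0 < C ∧ ∀ x : Fin 4 → ℚ, (∀ j, 0 < x j) →
      C⁻¹ * ((prodHeight x : ℕ) : ℝ) ^ (-(1 + ε)) ≤ |fourLog x| := by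
  intro h
  obtain ⟨C, hC, hh⟩ := h 1 one_pos
  have := hh (fun _ => 1) (fun _ => one_pos)
  simp [fourLog, prodHeight] at this
  exact absurd this (not_le.mpr hC)

/-! ## G. Near-misses (sorried; this workfile only) -/

/-- NEAR-MISS 1 (OPEN). **Unconditional refutation of the `ε = 0` cell statement.**  Obstruction:
the cell condition `ω₅ ≤ K` is an upper bound, so an infinite witness family with `c/rad → ∞` needs
certified bounded depth of the cofactor; for exponential families this is a Wieferich-type finiteness
(`epsZero_imp_wieferich_infinite` is the exact residue for `T_k`; for `(1, 2^{p(p−1)} − 1, 2^{p(p−1)})`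
it is "`p − 1` fourth-power-free for infinitely many primes `p`" (Mirsky) PLUS finiteness of
`{q : q⁵ ∣ 2^{ord_q 2} − 1}`), and polynomial families have `c/rad → 0` (Mason–Stothers).  Tried: GT and
BG families (depth uncontrolled), Pell `x² − d³y² = 1` (BarrierNotes-r1-k1 B2: `c/rad ≍ √d` but each
`d` needs a cube-free solution), dichotomy on `#W` (does not close: the second branch only re-enters
the family `T_k`). -/
theorem not_epsZero : ¬ EpsZero := by
  sorry

/-- NEAR-MISS 2 (OPEN as far as searched). **Infinitely many 5-free abc triples of quality `> 1`.**
Census (kit j015220): 417 such triples with `c ≤ 3·10⁸`, record quality `1.29203`; the natural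
infinite supplies — Pell orbits `(1, 2y², x²)`, `x² − 2y² = 1` at odd index (`(1, 9800, 9801)`,
`(1, 2³13⁴239², 114243²)`, …) — are 5-free exactly when the Lucas terms are cube-free off `2`, and
cube-freeness of Lucas sequences along any infinite index set is open (prime indices isolate
primitive divisors but `v_q` at the rank of apparition is Wall–Sun–Sun-type).  A proof would show the
cell-0 statement is not "eventually vacuous at quality 1"; its absence does not affect the crux. -/
theorem cellZero_quality_gt_one_infinite :
    {t : ℕ × ℕ × ℕ | IsABCTriple t.1 t.2.1 t.2.2 ∧ omega5 (t.1 * t.2.1 * t.2.2) = 0 ∧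
      rad t.1 t.2.1 t.2.2 < t.2.2}.Infinite := by
  sorry

end Summit.ABC.ABC.Cruxes.DepthCountedABC.Disproof
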